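import Summits.PneNP.PneNP.Theorems.PermanentDescentCollapseMakesPermanentEasyIslandDefs
import HarnessLib

/-!
# Route PermanentDescent, crux `CollapseMakesPermanentEasy` (stmt-PneNP-16142), line `Sketch`
# (idea `errorless-islands`): the bridge, part A — decoding one permanent residue on a line

Facts about the objects of `PermanentDescentCollapseMakesPermanentEasyIslandDefs.lean` used by the seam
`stub_bridge` of the skeleton `Cruxes/CollapseMakesPermanentEasy/Lines/Sketch.lean`:

* algebra of the encodings: the permanent commutes with ring maps (`ringHom_map_permanent`,
  `natCast_permanent`); residue lists and matrices over `ZMod p` round-trip (`matOfRes_resOfMat`,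
  `resOfMat_matOfRes`); the 0/1 word reads as the cast matrix (`matOfRes_resOfWord`); the list-level line
  point `linePt p c m d` IS `M + c • D` (`matOfRes_linePt`) and is well formed;
* the certified points of a line (`mem_certPts_iff`, their parameters form a sublist of the parameter
  list, a lower bound on their number);
* DECODING (the heart of Lipton's random self-reduction in erasure form): on a SOUND island every
  certified value is the true residue (`certVal_sound`); hence every successful `lineTry` returns
  `perm(M) mod p` — interpolation at `0` of the degree-`≤ n` line polynomial from `n + 1` TRUE points with
  distinct nonzero parameters (`lineTry_sound`, from the interpolation statements of Stub I taken as
  hypotheses); a direction whose line meets the certified slice in `≥ n + 1` nonzero parameters succeeds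
  (`lineTry_isSome`); so on a prime record whose advice directions hit the slice through EVERY matrix the
  decoded residue `resFor` is `perm(M_s) mod p` (`resFor_eq`).

Sources: R. J. Lipton, *New directions in testing*, DIMACS Ser. 2 (1991), §3; S. Arora, B. Barak,
*Computational Complexity* (2009), §8.6.2 (Thm. 8.33).
-/

set_option linter.dupNamespace false -- `Summit.PneNP.PneNP.…`: summit = sub-problem name (D-0017 single-conjunct layout)

namespace Summit.PneNP.PneNP.Theorems.PermIsland

open _root_.Computability Polynomial
open Literature.Computability.Complexity Literature.Computability.Complexity.Brick
  Literature.Computability.Complexity.CodeFP Literature.Computability.Complexity.ModArith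
open Summit.PneNP.PneNP.Theorems.PermCert

/-! ### Algebra of the encodings -/

section Algebra

variable {p n : ℕ}

/-- The permanent commutes with ring homomorphisms. [folklore] -/
theorem ringHom_map_permanent {R S : Type*} [CommSemiring R] [CommSemiring S] (f : R →+* S) {m : ℕ}
    (M : Matrix (Fin m) (Fin m) R) : f M.permanent = (M.map f).permanent := by
  unfold Matrix.permanent
  rw [map_sum]
  refine Finset.sum_congr rfl fun σ _ => ?_
  rw [map_prod]
  rfl

/-- The permanent of a matrix of naturals, cast: `↑(perm M) = perm (M.map Nat.cast)`. [folklore] -/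
theorem natCast_permanent {R : Type*} [CommSemiring R] {m : ℕ} (M : Matrix (Fin m) (Fin m) ℕ) :
    ((M.permanent : ℕ) : R) = (M.map (Nat.cast : ℕ → R)).permanent := by
  have h := ringHom_map_permanent (Nat.castRingHom R) M
  rwa [Nat.coe_castRingHom] at h

/-- Reading back a matrix from its residue list. [folklore] -/
theorem matOfRes_resOfMat [NeZero p] (M : Matrix (Fin n) (Fin n) (ZMod p)) : matOfRes p n (resOfMat M) = M := by
  ext a b
  unfold matOfRes resOfMat
  rw [Matrix.of_apply]
  have hidx : (b : ℕ) + n * (a : ℕ) < n * n := by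
    have := (finProdFinEquiv (m := n) (n := n) (a, b)).isLt
    simpa using this
  rw [List.getD_eq_getElem _ _ (by rw [List.length_ofFn]; exact hidx), List.getElem_ofFn]
  have hsymm : (finProdFinEquiv (m := n) (n := n)).symm ⟨(b : ℕ) + n * (a : ℕ), hidx⟩ = (a, b) := by
    rw [Equiv.symm_apply_eq]
    ext
    simp
  rw [hsymm]
  exact ZMod.natCast_zmod_val _

/-- Writing out the matrix of a reduced residue list gives the list back. [folklore] -/
theorem resOfMat_matOfRes [NeZero p] {l : List ℕ} (hl : l.length = n * n) (hlt : ∀ x ∈ l, x < p) :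
    resOfMat (matOfRes p n l) = l := by
  unfold resOfMat matOfRes
  apply List.ext_getElem
  · rw [List.length_ofFn, hl]
  · intro t h1 h2
    rw [List.getElem_ofFn]
    simp only [Matrix.of_apply]
    rw [ZMod.val_natCast]
    have ht : (((finProdFinEquiv (m := n) (n := n)).symm ⟨t, by rwa [List.length_ofFn] at h1⟩).2 : ℕ) +
        n * (((finProdFinEquiv (m := n) (n := n)).symm ⟨t, by rwa [List.length_ofFn] at h1⟩).1 : ℕ) = t := by
      have := congrArg Fin.val ((finProdFinEquiv (m := n) (n := n)).apply_symm_apply ⟨t, by rwa [List.length_ofFn] at h1⟩)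
      simpa using this
    rw [ht, List.getD_eq_getElem _ _ h2]
    exact Nat.mod_eq_of_lt (hlt _ (List.getElem_mem h2))

/-- The residue list of a 0/1 word reads as the word's matrix cast to `ZMod p`. [folklore] -/
theorem matOfRes_resOfWord (p n : ℕ) (s : List Bool) :
    matOfRes p n (resOfWord s) = (matOfWord n s).map (Nat.cast : ℕ → ZMod p) := by
  ext a b
  simp only [matOfRes, resOfWord, matOfWord, Matrix.map_apply, Matrix.of_apply, List.getD_eq_getElem?_getD,
    List.getElem?_map]
  cases s[(b : ℕ) + n * (a : ℕ)]? <;> rfl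

/-- **The points of the line**: the residue list `linePt p c m d` reads as `M + c • D`. [folklore] -/
theorem matOfRes_linePt (c : ℕ) {m d : List ℕ} (hm : m.length = n * n) (hd : d.length = n * n) :
    matOfRes p n (linePt p c m d) = matOfRes p n m + (c : ZMod p) • matOfRes p n d := by
  ext a b
  simp only [matOfRes, linePt, Matrix.add_apply, Matrix.smul_apply, Matrix.of_apply, smul_eq_mul]
  have hidx : (b : ℕ) + n * (a : ℕ) < n * n := by
    have := (finProdFinEquiv (m := n) (n := n) (a, b)).isLt
    simpa using this
  rw [List.getD_eq_getElem _ _ (by rw [List.length_zipWith, hm, hd, min_self]; exact hidx),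
    List.getElem_zipWith, List.getD_eq_getElem _ _ (by rw [hm]; exact hidx),
    List.getD_eq_getElem _ _ (by rw [hd]; exact hidx), natCast_addM, natCast_mulM]

/-- The points of the line are well-formed residue lists. [folklore] -/
theorem length_linePt (c : ℕ) {m d : List ℕ} (hm : m.length = n * n) (hd : d.length = n * n) :
    (linePt p c m d).length = n * n := by
  rw [linePt, List.length_zipWith, hm, hd, min_self]

/-- The entries of a line point are reduced (for a positive modulus). [folklore] -/
theorem lt_of_mem_linePt (hp : 0 < p) (c : ℕ) (m d : List ℕ) : ∀ x ∈ linePt p c m d, x < p := by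
  intro x hx
  unfold linePt at hx
  obtain ⟨a, _, b, _, rfl⟩ := CodeFP.exists_of_mem_zipWith hx
  exact Nat.mod_lt _ hp

end Algebra

/-! #### The certified points of a line -/

section LineFacts

variable (χ : List Bool → Bool) (p n : ℕ) (vs : List ℕ)

/-- Membership in `certPts`: a certified point is `(c, v)` with `c ∈ ls` and `v` the certified value at the
point of parameter `c`. [folklore] -/
theorem mem_certPts_iff (ls m d : List ℕ) (q : ℕ × ℕ) :
    q ∈ certPts χ p n vs ls m d ↔ q.1 ∈ ls ∧ certVal χ p n vs (linePt p q.1 m d) = some q.2 := by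
  unfold certPts
  rw [List.mem_flatten]
  constructor
  · rintro ⟨l, hl, hq⟩
    obtain ⟨c, hc, rfl⟩ := List.mem_map.1 hl
    rcases h : certVal χ p n vs (linePt p c m d) with _ | v
    · simp [h] at hq
    · simp only [h, Option.map_some, Option.toList_some, List.mem_singleton] at hq
      subst hq
      exact ⟨hc, h⟩
  · rintro ⟨hc, hq⟩
    refine ⟨[(q.1, q.2)], List.mem_map.2 ⟨q.1, hc, by simp [hq]⟩, by simp⟩

/-- The parameters of the certified points form a sublist of `ls`. [folklore] -/
theorem map_fst_certPts_sublist (ls m d : List ℕ) :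
    ((certPts χ p n vs ls m d).map Prod.fst).Sublist ls := by
  unfold certPts
  induction ls with
  | nil => simp
  | cons c ls ih =>
    rw [List.map_cons, List.flatten_cons, List.map_append]
    have h1 : ((((certVal χ p n vs (linePt p c m d)).map (Prod.mk c)).toList).map Prod.fst).Sublist [c] := by
      cases certVal χ p n vs (linePt p c m d) <;> simp
    exact h1.append ih

/-- A lower bound on the number of certified points: every parameter of `ls` satisfying `good` at which a
value is certified contributes a point. [folklore] -/
theorem length_filter_le_length_certPts (ls m d : List ℕ) (good : ℕ → Bool)
    (h : ∀ c ∈ ls, good c = true → (certVal χ p n vs (linePt p c m d)).isSome = true) :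
    (ls.filter good).length ≤ (certPts χ p n vs ls m d).length := by
  unfold certPts
  induction ls with
  | nil => simp
  | cons c ls ih =>
    have ih' := ih fun c' hc' => h c' (List.mem_cons_of_mem _ hc')
    rw [List.map_cons, List.flatten_cons, List.length_append, List.filter_cons]
    by_cases hg : good c = true
    · have hs := h c List.mem_cons_self hg
      obtain ⟨v, hv⟩ := Option.isSome_iff_exists.1 hs
      simp only [hg, if_true, List.length_cons, hv, Option.map_some, Option.toList_some]
      omega
    · rw [if_neg hg]
      omega

end LineFacts

/-! #### Decoding one residue: soundness of every success, existence of a success -/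

section Decode

variable {T : Language Bool} {χ : List Bool → Bool} (hχ : ∀ w, χ w = true ↔ w ∈ T) (hS : SoundIsland T)
variable {p n : ℕ} [hp : Fact p.Prime]
variable (hI1 : ∀ (p n : ℕ) (M D : Matrix (Fin n) (Fin n) (ZMod p)),
    ∃ f : Polynomial (ZMod p), f.natDegree ≤ n ∧ ∀ c : ZMod p, f.eval c = (M + c • D).permanent)
variable (hI2 : ∀ (p : ℕ) [Fact p.Prime] (f : Polynomial (ZMod p)) (pts : List (ℕ × ℕ)),
    f.natDegree < pts.length → (pts.map Prod.fst).Nodup →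
    (∀ q ∈ pts, q.1 < p ∧ (q.2 : ZMod p) = f.eval (q.1 : ZMod p)) →
    (lagrAt0 p pts : ZMod p) = f.eval 0)

include hχ hS in
/-- **A certified value on the line is the true permanent residue** (soundness of the island, on the
well-formed point `linePt p c m d`). [cite: AroraBarakCC2009, §8.6.2] -/
theorem certVal_sound {vs m d : List ℕ} (hm : m.length = n * n) (hd : d.length = n * n) {c v : ℕ}
    (h : certVal χ p n vs (linePt p c m d) = some v) :
    (v : ZMod p) = (matOfRes p n m + (c : ZMod p) • matOfRes p n d).permanent := by
  unfold certVal at h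
  have hχv := List.find?_some h
  have hT := (hχ _).1 hχv
  have hv := hS p n (linePt p c m d) v hp.out (length_linePt c hm hd) (lt_of_mem_linePt hp.out.pos c m d) hT
  rw [hv, permRes, matOfRes_linePt c hm hd, ZMod.natCast_zmod_val]

include hχ hS hI1 hI2 in
/-- **Every successful decoding attempt is correct**: if `lineTry` returns a value on a direction of the
right length, that value is `perm(M) mod p` (interpolation of the degree-`≤ n` line polynomial from `n + 1`
true points with distinct nonzero parameters). [cite: AroraBarakCC2009, §8.6.2] -/
theorem lineTry_sound {m d : List ℕ} (hm : m.length = n * n) (hd : d.length = n * n) {v : ℕ}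
    (h : lineTry χ p n (List.range p) ((List.range (p - 1)).map (· + 1)) m d = some v) :
    (v : ZMod p) = (matOfRes p n m).permanent ∧ v < p := by
  unfold lineTry at h
  split_ifs at h with hcnt
  set pts := (certPts χ p n (List.range p) ((List.range (p - 1)).map (· + 1)) m d).take (n + 1) with hpts
  have hv : v = lagrAt0 p pts := (Option.some.inj h).symm
  obtain ⟨f, hfdeg, hf⟩ := hI1 p n (matOfRes p n m) (matOfRes p n d)
  have hlen : pts.length = n + 1 := by rw [hpts, List.length_take, min_eq_left hcnt]
  have hls : ((List.range (p - 1)).map (· + 1)).Nodup :=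
    (List.nodup_range).map fun a b h => by simpa using h
  have hnd : (pts.map Prod.fst).Nodup := by
    rw [hpts, List.map_take]
    exact (List.take_sublist _ _).nodup ((map_fst_certPts_sublist χ p n (List.range p) _ m d).nodup hls)
  have hpt : ∀ q ∈ pts, q.1 < p ∧ (q.2 : ZMod p) = f.eval (q.1 : ZMod p) := by
    intro q hq
    have hq' : q ∈ certPts χ p n (List.range p) ((List.range (p - 1)).map (· + 1)) m d :=
      List.take_subset _ _ hq
    rw [mem_certPts_iff] at hq'
    obtain ⟨hc, hcv⟩ := hq'
    obtain ⟨j, hj, hjq⟩ := List.mem_map.1 hc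
    refine ⟨by rw [← hjq]; have := List.mem_range.1 hj; omega, ?_⟩
    rw [hf, certVal_sound hχ hS hm hd hcv]
  have key := hI2 p f pts (by omega) hnd hpt
  refine ⟨?_, ?_⟩
  · rw [hv, key, hf, zero_smul, add_zero]
  · rw [hv]
    unfold lagrAt0
    rw [sumM_eq]
    exact Nat.mod_lt _ hp.out.pos

include hχ in
/-- **A good direction succeeds**: if `≥ n + 1` nonzero parameters `c` put `M + cD` into the island (with
its true value), then `lineTry` along `d = resOfMat D` returns a value. [cite: AroraBarakCC2009, §8.6.2] -/
theorem lineTry_isSome {m : List ℕ} (hm : m.length = n * n) (Sp : Finset (Matrix (Fin n) (Fin n) (ZMod p)))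
    (hSp : ∀ M, M ∈ Sp → encIsland p n (resOfMat M) (M.permanent).val ∈ T) (D : Matrix (Fin n) (Fin n) (ZMod p))
    (hD : n + 1 ≤ (Finset.univ.filter fun c : ZMod p => c ≠ 0 ∧ matOfRes p n m + c • D ∈ Sp).card) :
    (lineTry χ p n (List.range p) ((List.range (p - 1)).map (· + 1)) m (resOfMat D)).isSome = true := by
  classical
  set d := resOfMat D with hdD
  have hd : d.length = n * n := by rw [hdD, resOfMat, List.length_ofFn]
  set ls := (List.range (p - 1)).map (· + 1) with hls
  -- the good parameters, as naturals
  let good : ℕ → Bool := fun c =>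
    decide (encIsland p n (linePt p c m d) ((matOfRes p n (linePt p c m d)).permanent).val ∈ T)
  have hcert : ∀ c ∈ ls, good c = true →
      (certVal χ p n (List.range p) (linePt p c m d)).isSome = true := by
    intro c _ hg
    simp only [good, decide_eq_true_eq] at hg
    unfold certVal
    rw [List.find?_isSome]
    exact ⟨_, List.mem_range.2 (ZMod.val_lt _), (hχ _).2 hg⟩
  have h1 := length_filter_le_length_certPts χ p n (List.range p) ls m d good hcert
  -- the nonzero residues with the property inject into the good naturals of `ls`
  have h2 : (Finset.univ.filter fun c : ZMod p => c ≠ 0 ∧ matOfRes p n m + c • D ∈ Sp).card ≤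
      (ls.filter good).toFinset.card := by
    refine Finset.card_le_card_of_injOn (fun c : ZMod p => c.val) (fun c hc => ?_) fun a _ b _ h => ZMod.val_injective p h
    rw [Finset.mem_coe, Finset.mem_filter] at hc
    obtain ⟨_, hc0, hcS⟩ := hc
    rw [Finset.mem_coe, List.mem_toFinset, List.mem_filter]
    have hval : 0 < c.val := Nat.pos_of_ne_zero fun h => hc0 ((ZMod.val_eq_zero c).1 h)
    refine ⟨?_, ?_⟩
    · show c.val ∈ ls
      exact List.mem_map.2 ⟨c.val - 1, List.mem_range.2 (by have := ZMod.val_lt c; omega), Nat.sub_add_cancel hval⟩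
    have hpt : matOfRes p n (linePt p c.val m d) = matOfRes p n m + c • D := by
      rw [matOfRes_linePt c.val hm hd, ZMod.natCast_zmod_val, hdD, matOfRes_resOfMat]
    have hres : resOfMat (matOfRes p n m + c • D) = linePt p c.val m d := by
      rw [← hpt, resOfMat_matOfRes (length_linePt _ hm hd) (lt_of_mem_linePt hp.out.pos _ _ _)]
    have hcT := hSp _ hcS
    rw [hres] at hcT
    simpa only [good, hpt, decide_eq_true_eq] using hcT
  have h3 := List.toFinset_card_le (ls.filter good)
  unfold lineTry
  rw [if_pos (by omega)]
  rfl

include hχ hS hI1 hI2 in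
/-- **The decoded residue is correct**: on the prime record `(p, [0..p-1], [1..p-1], e, dirs)` whose
directions hit the island through every matrix, `resFor` returns `perm(M_s) mod p`.
[cite: Lipton1991, §3] [cite: AroraBarakCC2009, §8.6.2] -/
theorem resFor_eq {s : List Bool} (hs : s.length = n * n) (e : ℕ) (Sp : Finset (Matrix (Fin n) (Fin n) (ZMod p)))
    (hSp : ∀ M, M ∈ Sp → encIsland p n (resOfMat M) (M.permanent).val ∈ T)
    (dirs : List (Matrix (Fin n) (Fin n) (ZMod p)))
    (hdirs : ∀ M : Matrix (Fin n) (Fin n) (ZMod p), ∃ D ∈ dirs,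
      n + 1 ≤ (Finset.univ.filter fun c : ZMod p => c ≠ 0 ∧ M + c • D ∈ Sp).card) :
    resFor χ n (p, List.range p, (List.range (p - 1)).map (· + 1), e, dirs.map resOfMat) (resOfWord s) =
      permWord n s % p := by
  have hm : (resOfWord s).length = n * n := by rw [resOfWord, List.length_map, hs]
  unfold resFor
  simp only
  rcases h : (dirs.map resOfMat).findSome?
      (fun d => lineTry χ p n (List.range p) ((List.range (p - 1)).map (· + 1)) (resOfWord s) d) with _ | v
  · -- no success: impossible
    exfalso
    obtain ⟨D, hD, hcnt⟩ := hdirs (matOfRes p n (resOfWord s))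
    have hsome := lineTry_isSome (p := p) hχ hm Sp hSp D hcnt
    rw [List.findSome?_eq_none_iff] at h
    have := h (resOfMat D) (List.mem_map.2 ⟨D, hD, rfl⟩)
    rw [this] at hsome
    exact Bool.false_ne_true hsome
  · obtain ⟨d, hd, hdv⟩ := List.exists_of_findSome?_eq_some h
    obtain ⟨D, _, rfl⟩ := List.mem_map.1 hd
    have hdl : (resOfMat D).length = n * n := by rw [resOfMat, List.length_ofFn]
    obtain ⟨hv, hvlt⟩ := lineTry_sound hχ hS hI1 hI2 hm hdl hdv
    rw [matOfRes_resOfWord, ← natCast_permanent] at hv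
    change v = permWord n s % p
    rw [permWord, ← Nat.mod_eq_of_lt hvlt]
    exact (ZMod.natCast_eq_natCast_iff' _ _ _).1 hv

end Decode

end Summit.PneNP.PneNP.Theorems.PermIsland
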